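import Mathlib.Geometry.Manifold.LocalDiffeomorph
import Literature.Geometry.Riemannian.RicciFlowMaximal
import Literature.Geometry.Riemannian.CurvatureNormSq
import Literature.Geometry.Riemannian.ChangGurskyYangProofs
import Literature.Geometry.Riemannian.CanonicalNeighbourhoods
import HarnessLib

/-!
# Hamilton's compactness theorem for solutions of the Ricci flow (time-zero slice, dimension four)
(topic `Geometry/Riemannian`; named fact, wanted by the crux `ChangGurskyYang` of route
`SmoothPoincare4/EntropyRung`, item stmt-SmoothPoincare4-10834, line `margerin-cone-hamilton-rails`, to
derive the blow-up limit `ricciFlow_blowupLimit_four` (`RicciFlowBlowupLimit.lean`) from it over the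
tree's proved maximal-existence / curvature blow-up / no-local-collapsing library; also the missing
"Cheeger–Gromov–Hamilton compactness" input recorded in `CanonicalNeighbourhoodTheorem.lean`)

## The result

Hamilton 1995 [Hamilton1995Compactness], Main Theorem 1.2: let `(M_k, g_k(t), p_k)` be a sequence of
complete pointed solutions of the Ricci flow on a time interval containing `(−a, 0]`, with uniformly
bounded curvature `|Rm| ≤ C` on `M_k × (−a, 0]` and injectivity radii `inj(M_k, g_k(0), p_k) ≥ ι > 0`.
Then a subsequence converges, in the pointed `C^∞_loc` (Cheeger–Gromov) sense, to a complete pointed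
solution `(N, ĝ(t), p_∞)` on `(−a, 0]`. Morgan–Tian 2007, Thm. 5.15 states it with the
injectivity-radius hypothesis replaced by the VOLUME lower bound `Vol B(p_k, 0, r₀) ≥ κ r₀ⁿ` for all
`k` (their hypothesis (4); equivalent under the curvature bound by Cheeger–Gromov–Taylor 1982, Thm. 4.7
and Bishop–Gromov), hypotheses (1)–(2) being automatic on closed manifolds; the convergence notion is
the geometric limit of Morgan–Tian Def. 5.3 (Petersen 2006, Ch. 10, §3.2), and the proof (Hamilton
1995 §2; Morgan–Tian §5.1–5.2) bounds all derivatives of curvature by Shi's estimates and applies the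
compactness theorem for Riemannian manifolds (Hamilton 1995, Thm. 2.3; Morgan–Tian Thm. 5.9 /
Cor. 5.10).

## Vended form (`hamilton_compactness_ricciFlow_slice_four`)

The special case and consequences the consumer needs, over the tree's vocabulary: all `M_k` are ONE
closed connected 4-manifold `M` on `ℝ⁴` (the blow-up of a flow on a fixed closed manifold);
`(g_k, cov_k)` are Ricci flows of Riemannian metrics on `[−A_k, 0]` with `A_k ≥ a > 0` (`IsRicciFlow`,
`RicciFlow.lean`, Levi-Civita witnesses `cov_k`); the curvature bound is the frame-wise
`CurvatureBoundedBy (g_k s) (cov_k s) C` of `RicciFlowMaximal.lean` (Topping (5.3.1); equivalent to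
`|Rm| ≤ C'` up to a dimensional constant); the volume hypothesis is Morgan–Tian's (4) on geodesic
balls and Riemannian volume of the slice `g_k 0` (`PseudoRiemannianMetric.ball`, `.vol`,
`CanonicalNeighbourhoods.lean`, the vocabulary of `IsKappaNoncollapsed`). CONCLUSION: a subsequence
`sub` and — of the limit solution — only its TIME-ZERO SLICE, exactly in the shape of
`ricciFlow_blowupLimit_four`: a connected Hausdorff second-countable `C^∞` 4-manifold `N` on `ℝ⁴`, a
`C^∞` Riemannian `h` with geodesically complete Levi-Civita connection, a base point `p_∞`, the data of
Morgan–Tian Def. 5.3 in diagonalised form (an increasing open exhaustion `U` of `N` with `p_∞ ∈ U 0`;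
comparison maps `φₙ : N → M`, total, injective `C^∞` local diffeomorphisms ON `U n`, `φₙ p_∞ = p_{sub n}`),
the `C⁰` convergence `g_{sub n}(0)(dφₙ v, dφₙ w) → h(v, w)`, and the pointwise convergence along `φₙ` of
the curvature invariants `R`, `|Rm|²` (`curvNormSqWith`), `|W|²` (`weylNormSq`), `|E|²`
(`tracelessRicciNormSq`) of `g_{sub n}(0)` to those of `h` — consequences of the `C^∞_loc` convergence
`φₙ^* g_{sub n}(0) → h` and of the naturality of curvature invariants (O'Neill 1983, Prop. 3.59).
Honest WEAKENING of the printed conclusion (no later times, no covering clause, no `Cᵏ` norms).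

## Design notes (for the reviewer)

* Junk audit: `a > 0`, `κ > 0`, `r₀ > 0` explicit; a non-positive `C` only makes the hypothesis
  unsatisfiable when some `g_k s` is non-flat (vacuous, not false); all per-`k` hypotheses are
  imposed for every `k` (Morgan–Tian: "for all `k` sufficiently large" — a consumer reindexes);
  `M` nonempty (`ConnectedSpace`), `N` nonempty (`p_∞`); `[MeasurableSpace M] [BorelSpace M]` only
  to speak of volumes (`vol` is the Riemannian measure for Riemannian slices). The limit `N` need not
  be diffeomorphic to `M` (it is when `N` is compact — proved consumer-side,
  `Summits/…/EntropyRungChangGurskyYangStubTransfer.lean`).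
* Relation to the tree: `ricciFlow_blowupLimit_four` (Topping 2006, Thm. 8.5.1) is this fact applied to
  the parabolic rescalings `Qₙ g(tₙ + s/Qₙ)` at Topping's blow-up sequence, the volume hypothesis
  coming from `perelman_noLocalCollapsing_holds` + `IsKappaNoncollapsed.parabolicRescale`, the
  curvature bound from the point picking (`curvatureBoundedBy_of_curvNormSqWith_le`,
  `curvatureBoundedBy_constSmul_iff`); that derivation is carried out problem-side.
-- TODO(general form): Hamilton 1995, Thm. 1.2 verbatim — varying complete (possibly non-compact)
-- `M_k` of any dimension, curvature bounds only on compact sub-intervals / balls, the limit as a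
-- complete pointed SOLUTION `(N, ĝ(t), p_∞)` on `(−a, 0]` (and on `(α, ω)` in general) with full
-- `Cᵏ_loc` convergence of `φₙ^* g_{sub n}(t)` and the covering clause (Morgan–Tian Def. 5.3 (2b));
-- the injectivity-radius form of the hypothesis; and the underlying compactness theorem for pointed
-- Riemannian manifolds with bounds on `|∇ˡ Rm|` (Hamilton 1995, Thm. 2.3; Morgan–Tian Thm. 5.9,
-- Cor. 5.10) as its own named fact.

## References

* [Hamilton1995Compactness] R. S. Hamilton, *A compactness property for solutions of the Ricci flow*,
  Amer. J. Math. 117 (1995) 545–572, Thm. 1.2 (main theorem), Thm. 2.3, §2.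
* [MorganTian2007] J. Morgan, G. Tian, *Ricci Flow and the Poincaré Conjecture* (2007) =
  arXiv:math/0607607, Def. 5.3, Thm. 5.9, Cor. 5.10, Thm. 5.15 (page-read 2026-08-16).
* [CheegerGromovTaylor1982] J. Cheeger, M. Gromov, M. Taylor, J. Differential Geom. 17 (1982) 15–53,
  Thm. 4.7.
* [Topping2006] P. Topping, *Lectures on the Ricci flow* (2006), §7.1–§7.3, §8.4–§8.5.
* [Petersen2006] P. Petersen, *Riemannian Geometry*, 2nd ed. (2006), Ch. 10, §3.2.
* [ONeill1983] B. O'Neill, *Semi-Riemannian geometry* (1983), Ch. 3, Prop. 3.59.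
-/

noncomputable section

open Set Function Filter
open scoped Manifold ContDiff Topology ENNReal

namespace Literature.Geometry.Riemannian

open Literature.Geometry.Lorentzian Literature.Geometry.Lorentzian.PseudoRiemannianMetric

/-- NAMED FACT (**Hamilton 1995, "A compactness property for solutions of the Ricci flow",
Thm. 1.2**, in the volume form of **Morgan–Tian 2007, Thm. 5.15** (hypothesis (4):
`Vol B(x_k, 0, r₀) ≥ κ r₀ⁿ`; Cheeger–Gromov–Taylor 1982, Thm. 4.7), convergence = geometric limit of
Morgan–Tian Def. 5.3). **Vended form** (module docstring): a sequence of Ricci flows of Riemannian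
metrics `(g_k, cov_k)` on `[−A_k, 0]`, `A_k ≥ a > 0`, on ONE closed connected 4-manifold `M`, with
`CurvatureBoundedBy (g_k s) (cov_k s) C` at all times and `Vol_{g_k(0)} B_{g_k(0)}(p_k, r₀) ≥ κ r₀⁴`,
has a subsequence `sub` whose time-zero slices `(M, g_{sub n}(0), p_{sub n})` converge to a complete
connected pointed Riemannian 4-manifold `(N, h, p_∞)`: an increasing open exhaustion `U` of `N`,
comparison maps `φₙ : N → M` that are injective `C^∞` local diffeomorphisms on `U n` with
`φₙ p_∞ = p_{sub n}`, `C⁰` convergence of `φₙ^* g_{sub n}(0)` to `h` on tangent vectors, and pointwise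
convergence along `φₙ` of `R`, `|Rm|²`, `|W|²`, `|E|²` of `g_{sub n}(0)` to those of `h`.
Users take `(h : hamilton_compactness_ricciFlow_slice_four)`.
[cite: Hamilton1995Compactness, Thm. 1.2] -/
def hamilton_compactness_ricciFlow_slice_four : Prop :=
  ∀ (M : Type) [TopologicalSpace M] [T2Space M] [SecondCountableTopology M]
    [ChartedSpace (EuclideanSpace ℝ (Fin 4)) M]
    [IsManifold (modelWithCornersSelf ℝ (EuclideanSpace ℝ (Fin 4))) ((⊤ : ℕ∞) : WithTop ℕ∞) M]
    [CompactSpace M] [ConnectedSpace M] [MeasurableSpace M] [BorelSpace M]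
    (g : ℕ → ℝ → PseudoRiemannianMetric (modelWithCornersSelf ℝ (EuclideanSpace ℝ (Fin 4)))
      ((⊤ : ℕ∞) : WithTop ℕ∞) (EuclideanSpace ℝ (Fin 4))
      (TangentSpace (modelWithCornersSelf ℝ (EuclideanSpace ℝ (Fin 4))) : M → Type _))
    (cov : ℕ → ℝ → CovariantDerivative (modelWithCornersSelf ℝ (EuclideanSpace ℝ (Fin 4)))
      (EuclideanSpace ℝ (Fin 4))
      (TangentSpace (modelWithCornersSelf ℝ (EuclideanSpace ℝ (Fin 4))) : M → Type _))
    (A : ℕ → ℝ) (p : ℕ → M) (C a κ r₀ : ℝ), 0 < a → 0 < κ → 0 < r₀ → (∀ k, a ≤ A k) →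
    (∀ k, IsRicciFlow (g k) (cov k) (Icc (-(A k)) 0)) →
    (∀ k, ∀ s ∈ Icc (-(A k)) 0, (g k s).IsRiemannian) →
    (∀ k, ∀ s ∈ Icc (-(A k)) 0, CurvatureBoundedBy (g k s) (cov k s) C) →
    (∀ k, ENNReal.ofReal (κ * r₀ ^ 4) ≤ (g k 0).vol ((g k 0).ball (p k) (ENNReal.ofReal r₀))) →
    ∃ (sub : ℕ → ℕ), StrictMono sub ∧
    ∃ (N : Type) (_ : TopologicalSpace N) (_ : T2Space N) (_ : SecondCountableTopology N)
      (_ : ChartedSpace (EuclideanSpace ℝ (Fin 4)) N)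
      (_ : IsManifold (modelWithCornersSelf ℝ (EuclideanSpace ℝ (Fin 4))) ((⊤ : ℕ∞) : WithTop ℕ∞) N)
      (_ : ConnectedSpace N)
      (h : PseudoRiemannianMetric (modelWithCornersSelf ℝ (EuclideanSpace ℝ (Fin 4)))
        ((⊤ : ℕ∞) : WithTop ℕ∞) (EuclideanSpace ℝ (Fin 4))
        (TangentSpace (modelWithCornersSelf ℝ (EuclideanSpace ℝ (Fin 4))) : N → Type _))
      (_ : h.HasLeviCivita) (_ : h.IsRiemannian) (pinf : N) (U : ℕ → Set N) (φ : ℕ → N → M),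
      IsGeodesicallyComplete h.leviCivita ∧
      (∀ n, IsOpen (U n)) ∧ Monotone U ∧ pinf ∈ U 0 ∧ (⋃ n, U n) = univ ∧
      (∀ n, IsLocalDiffeomorphOn (modelWithCornersSelf ℝ (EuclideanSpace ℝ (Fin 4)))
        (modelWithCornersSelf ℝ (EuclideanSpace ℝ (Fin 4))) ((⊤ : ℕ∞) : WithTop ℕ∞) (φ n) (U n)) ∧
      (∀ n, InjOn (φ n) (U n)) ∧
      (∀ n, φ n pinf = p (sub n)) ∧
      (∀ (y : N) (v w : TangentSpace (modelWithCornersSelf ℝ (EuclideanSpace ℝ (Fin 4))) y),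
        Tendsto (fun n ↦ (g (sub n) 0).val (φ n y)
          (mfderiv (modelWithCornersSelf ℝ (EuclideanSpace ℝ (Fin 4)))
            (modelWithCornersSelf ℝ (EuclideanSpace ℝ (Fin 4))) (φ n) y v)
          (mfderiv (modelWithCornersSelf ℝ (EuclideanSpace ℝ (Fin 4)))
            (modelWithCornersSelf ℝ (EuclideanSpace ℝ (Fin 4))) (φ n) y w)) atTop (𝓝 (h.val y v w))) ∧
      (∀ y : N, Tendsto (fun n ↦ (g (sub n) 0).scalarCurvatureWith (cov (sub n) 0) (φ n y))
        atTop (𝓝 (h.scalarCurvature y))) ∧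
      (∀ y : N, Tendsto (fun n ↦ (g (sub n) 0).curvNormSqWith (cov (sub n) 0) (φ n y))
        atTop (𝓝 (h.curvNormSqWith h.leviCivita y))) ∧
      (∀ y : N, Tendsto (fun n ↦ haveI := (g (sub n) 0).hasLeviCivita
          (g (sub n) 0).weylNormSq (φ n y)) atTop (𝓝 (h.weylNormSq y))) ∧
      (∀ y : N, Tendsto (fun n ↦ haveI := (g (sub n) 0).hasLeviCivita
          (g (sub n) 0).tracelessRicciNormSq (φ n y)) atTop (𝓝 (h.tracelessRicciNormSq y)))

end Literature.Geometry.Riemannian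

end
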